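import Literature.IUT.HodgeArakelov.RealifiedPrimeStripSplitMuLift
import HarnessLib

/-!
# The ∀-form "kit rule" on print-level `F^{⊩▶×μ}`-prime-strips is unsatisfiable (kernel witness)

WITNESS file (abc-iut cell, wave-4 seat abc-iut-w4-d014, queue (2) RQ7 kernel probe; finding F-d014-RPS-1 on
p415182).  It asserts nothing about the mathematics of [IUTchII]; it records a fact about the tree's TYPES.
S. Mochizuki, *Inter-universal Teichmüller theory II*, kurims manuscript (Dec. 2020), Def. 4.9 (vii)–(viii) p. 158
(an `F^{⊩▶×μ}`-prime-strip is a collection of data modelled on — isomorphic to — the model data; a morphism is «an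
isomorphism between collections of data as discussed above»), Cor. 4.10 (iv) p. 160 [cite: Mochizuki2012, Def 4.9
(viii) p.158].  abc-iut-L6-t2's print-level groupoid `FVdashSplitTriMuPrimeStrip P G X`
(`RealifiedPrimeStripSplitCategories.lean`) types the strips with a FREE realified global Frobenioid field
`data.realifiedF : RealifiedGlobalFrobenioidF V` (objects `Obj : Type v`, an isomorphism relation, degrees), and a
morphism must carry a degree-respecting BIJECTION OF ISOMORPHISM CLASSES (`Hom.classEquiv`).  Consequently the
"kit rule" in the ∀-form used as a HYPOTHESIS by abc-iut-w4-d028's `mapIso_toTimesMu_surjective_of_model` /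
`map_full_toTimesMu_of_model` (p415182) — `hM : ∀ S, Nonempty (S ≅ M)` over the whole type — can never be
discharged:
* `withSingle S` / `withPair S` — the strip `S` with its realified Frobenioid replaced by a ONE-object one (the pilot,
  same local degrees) resp. a TWO-class one (pilot + an isolated degree-`0` object); every field law transfers, and the
  local `F^{⊢▶×μ}`-data — hence the `F^{⊢×μ}`-image — are UNCHANGED;
* `not_forall_nonempty_iso` — **for every `M`, `¬ ∀ S, Nonempty (S ≅ M)`** (if `M` has one class use `withPair M`,
  else `withSingle M`: no bijection of class sets exists);
* `map_full_toTimesMu_ne_full` — on the FULL type-groupoid the frame-level residual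
  `R : (PolyIso.full S T).map (F^{⊩▶×μ} ↦ F^{⊢×μ}) = PolyIso.full _ _` FAILS for some `S T` (take `T := withSingle M`
  or `withPair M`: `full M T = ∅` while the images coincide, so the right side contains `𝟙`).
Repair recorded with the finding: state the surjectivity per pair of strips in the model's connected component
(`mapIso_toTimesMu_surjective_of_iso`, already in p415182) and build strip frames on the full subgroupoid
`{S | Nonempty (S ≅ M)}`.  Claim key of the ambient interface `Mochizuki2012` DISPUTED (D-0012); nothing here takes
a side on [IUTchIII] Cor. 3.12.
-/

namespace Literature.IUT.HodgeArakelov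

open CategoryTheory
open Literature.IUT.HodgeTheaters (PolyIso)

universe u v w

/-! ### 1. Two small realified global Frobenioids -/

namespace RealifiedGlobalFrobenioidF

variable {V : Type u}

/-- The ONE-object realified global Frobenioid with prescribed (finitely supported) local degrees `d`.
[cite: Mochizuki2012, Def 4.9 (viii) p.158] -/
noncomputable def single (d : V → ℝ) (hd : (Function.support d).Finite) : RealifiedGlobalFrobenioidF.{u, v} V where
  Obj := PUnit.{v + 1}
  Iso _ _ := True
  iso_equivalence := ⟨fun _ => trivial, fun _ => trivial, fun _ _ => trivial⟩
  deg _ := ∑ᶠ v, d v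
  deg_iso _ _ _ := rfl
  localDeg _ := d
  localDeg_finite _ := hd
  deg_eq_finsum _ := rfl

/-- `single` has exactly one isomorphism class. [cite: Mochizuki2012, Def 4.9 (viii) p.158] -/
theorem subsingleton_isoClass_single (d : V → ℝ) (hd : (Function.support d).Finite) :
    Subsingleton (single.{u, v} d hd).IsoClass := by
  refine ⟨fun a b => ?_⟩
  obtain ⟨a, rfl⟩ := (single d hd).classOf_surjective a
  obtain ⟨b, rfl⟩ := (single d hd).classOf_surjective b
  exact ((single d hd).classOf_eq_classOf_iff a b).mpr trivial

/-- The TWO-class realified global Frobenioid: one object (`true`) with prescribed local degrees `d`, one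
isolated object (`false`) of local degrees `0`; isomorphism = equality. [cite: Mochizuki2012, Def 4.9 (viii) p.158] -/
noncomputable def pair (d : V → ℝ) (hd : (Function.support d).Finite) : RealifiedGlobalFrobenioidF.{u, v} V where
  Obj := ULift.{v} Bool
  Iso a b := a = b
  iso_equivalence := eq_equivalence
  deg a := if a.down = true then ∑ᶠ v, d v else 0
  deg_iso a b h := by subst h; rfl
  localDeg a := if a.down = true then d else 0
  localDeg_finite a := by
    by_cases h : a.down = true
    · simp only [h, if_true]; exact hd
    · simp only [h]; simp
  deg_eq_finsum a := by
    by_cases h : a.down = true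
    · simp only [h, if_true]
    · simp only [h]; simp

/-- The two objects of `pair` are NOT isomorphic. [cite: Mochizuki2012, Def 4.9 (viii) p.158] -/
theorem classOf_pair_ne (d : V → ℝ) (hd : (Function.support d).Finite) :
    (pair.{u, v} d hd).classOf ⟨true⟩ ≠ (pair.{u, v} d hd).classOf ⟨false⟩ := by
  intro h
  have h' := ((pair d hd).classOf_eq_classOf_iff _ _).mp h
  cases h'

/-- Hence `pair` does not have a subsingleton class set. [cite: Mochizuki2012, Def 4.9 (viii) p.158] -/
theorem not_subsingleton_isoClass_pair (d : V → ℝ) (hd : (Function.support d).Finite) :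
    ¬ Subsingleton (pair.{u, v} d hd).IsoClass :=
  fun _ => classOf_pair_ne d hd (Subsingleton.elim _ _)

end RealifiedGlobalFrobenioidF

/-! ### 2. Replacing the realified global Frobenioid of a strip -/

namespace FVdashSplitTriMuPrimeStrip

variable {V : Type u} {P : PlaceData V} {G : V → Type u} [∀ v, Group (G v)]
  {X : ∀ v, GroupTheoreticUnits.{u, w} (G v)}

/-- The strip `S` with `*C^⊩` replaced by the ONE-object Frobenioid on the pilot (same local degrees); the
`F^{⊢▶×μ}`-data, `ρ_v`, generators are those of `S`. [cite: Mochizuki2012, Def 4.9 (viii) p.158] -/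
noncomputable def withSingle (S : FVdashSplitTriMuPrimeStrip.{u, v, w} P G X) : FVdashSplitTriMuPrimeStrip.{u, v, w} P G X :=
  ⟨{ realifiedF := RealifiedGlobalFrobenioidF.single (S.data.realifiedF.localDeg S.data.pilot)
        (S.data.realifiedF.localDeg_finite S.data.pilot)
     strip := S.data.strip
     rho := S.data.rho
     triGen := S.data.triGen
     rho_triGen_pos := S.data.rho_triGen_pos
     pilot := PUnit.unit
     pilot_localDeg_bad := S.data.pilot_localDeg_bad
     pilot_localDeg_other := S.data.pilot_localDeg_other }⟩

/-- The strip `S` with `*C^⊩` replaced by the TWO-class Frobenioid (pilot + an isolated object); the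
`F^{⊢▶×μ}`-data, `ρ_v`, generators are those of `S`. [cite: Mochizuki2012, Def 4.9 (viii) p.158] -/
noncomputable def withPair (S : FVdashSplitTriMuPrimeStrip.{u, v, w} P G X) : FVdashSplitTriMuPrimeStrip.{u, v, w} P G X :=
  ⟨{ realifiedF := RealifiedGlobalFrobenioidF.pair (S.data.realifiedF.localDeg S.data.pilot)
        (S.data.realifiedF.localDeg_finite S.data.pilot)
     strip := S.data.strip
     rho := S.data.rho
     triGen := S.data.triGen
     rho_triGen_pos := S.data.rho_triGen_pos
     pilot := ⟨true⟩
     pilot_localDeg_bad := fun v h => by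
       simp only [RealifiedGlobalFrobenioidF.pair, if_true]
       exact S.data.pilot_localDeg_bad v h
     pilot_localDeg_other := fun v h => by
       simp only [RealifiedGlobalFrobenioidF.pair, if_true]
       exact S.data.pilot_localDeg_other v h }⟩

/-- Passing to `F^{⊢×μ}` does not see the realified global Frobenioid: `withSingle S` has the same image as `S`.
[cite: Mochizuki2012, Def 4.9 (vii) p.158] -/
theorem toTimesMu_obj_withSingle (S : FVdashSplitTriMuPrimeStrip.{u, v, w} P G X) :
    (toSplitStripFunctor ⋙ FSplitTriMuPrimeStrip.toTimesMuFunctor).obj (withSingle S) =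
      (toSplitStripFunctor ⋙ FSplitTriMuPrimeStrip.toTimesMuFunctor).obj S := rfl

/-- Passing to `F^{⊢×μ}` does not see the realified global Frobenioid: `withPair S` has the same image as `S`.
[cite: Mochizuki2012, Def 4.9 (vii) p.158] -/
theorem toTimesMu_obj_withPair (S : FVdashSplitTriMuPrimeStrip.{u, v, w} P G X) :
    (toSplitStripFunctor ⋙ FSplitTriMuPrimeStrip.toTimesMuFunctor).obj (withPair S) =
      (toSplitStripFunctor ⋙ FSplitTriMuPrimeStrip.toTimesMuFunctor).obj S := rfl

/-- A strip with at least two classes of `*C^⊩`-objects is NOT isomorphic to its one-object variant.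
[cite: Mochizuki2012, Def 4.9 (viii) p.158] -/
theorem not_iso_withSingle (M : FVdashSplitTriMuPrimeStrip.{u, v, w} P G X)
    (hM : ¬ Subsingleton M.data.realifiedF.IsoClass) (e : M ≅ withSingle M) : False :=
  hM (@Function.Injective.subsingleton _ _ e.hom.classEquiv e.hom.classEquiv.injective
    (RealifiedGlobalFrobenioidF.subsingleton_isoClass_single _ _))

/-- A strip with exactly one class of `*C^⊩`-objects is NOT isomorphic to its two-class variant.
[cite: Mochizuki2012, Def 4.9 (viii) p.158] -/
theorem not_iso_withPair (M : FVdashSplitTriMuPrimeStrip.{u, v, w} P G X)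
    (hM : Subsingleton M.data.realifiedF.IsoClass) (e : M ≅ withPair M) : False := by
  apply RealifiedGlobalFrobenioidF.classOf_pair_ne (M.data.realifiedF.localDeg M.data.pilot)
    (M.data.realifiedF.localDeg_finite M.data.pilot)
  apply e.hom.classEquiv.symm.injective
  exact Subsingleton.elim _ _

/-- **The ∀-form kit rule is unsatisfiable**: for every print-level `F^{⊩▶×μ}`-prime-strip `M` there is a strip of
the same type NOT isomorphic to `M` (so a hypothesis `∀ S, Nonempty (S ≅ M)` can never be discharged, and theorems
carrying it hold vacuously). [cite: Mochizuki2012, Def 4.9 (viii) p.158] -/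
theorem not_forall_nonempty_iso (M : FVdashSplitTriMuPrimeStrip.{u, v, w} P G X) :
    ¬ ∀ S : FVdashSplitTriMuPrimeStrip.{u, v, w} P G X, Nonempty (S ≅ M) := by
  intro h
  by_cases hM : Subsingleton M.data.realifiedF.IsoClass
  · obtain ⟨e⟩ := h (withPair M)
    exact not_iso_withPair M hM e.symm
  · obtain ⟨e⟩ := h (withSingle M)
    exact not_iso_withSingle M hM e.symm

/-- **The frame-level residual `R` fails on the full type-groupoid**: for every `M` there are strips `S T` with
`(PolyIso.full S T).map (F^{⊩▶×μ} ↦ F^{⊢×μ}) ≠ PolyIso.full _ _` — the left side is empty (no isomorphism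
`S ≅ T`) while the right side contains the identity (the images coincide). So a strip frame must be built on the
connected component of the model, not on the whole type. [cite: Mochizuki2012, Cor 4.10 (iv) p.160] -/
theorem map_full_toTimesMu_ne_full (M : FVdashSplitTriMuPrimeStrip.{u, v, w} P G X) :
    ∃ T : FVdashSplitTriMuPrimeStrip.{u, v, w} P G X,
      (PolyIso.full M T).map (toSplitStripFunctor ⋙ FSplitTriMuPrimeStrip.toTimesMuFunctor) ≠
        PolyIso.full _ _ := by
  by_cases hM : Subsingleton M.data.realifiedF.IsoClass
  · refine ⟨withPair M, fun hR => ?_⟩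
    have hmem : (Iso.refl _ : (toSplitStripFunctor ⋙ FSplitTriMuPrimeStrip.toTimesMuFunctor).obj M ≅
        (toSplitStripFunctor ⋙ FSplitTriMuPrimeStrip.toTimesMuFunctor).obj (withPair M)) ∈
        (PolyIso.full M (withPair M)).map (toSplitStripFunctor ⋙ FSplitTriMuPrimeStrip.toTimesMuFunctor) := by
      rw [hR]; exact PolyIso.mem_full _
    obtain ⟨e, -, -⟩ := PolyIso.mem_map.mp hmem
    exact not_iso_withPair M hM e
  · refine ⟨withSingle M, fun hR => ?_⟩
    have hmem : (Iso.refl _ : (toSplitStripFunctor ⋙ FSplitTriMuPrimeStrip.toTimesMuFunctor).obj M ≅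
        (toSplitStripFunctor ⋙ FSplitTriMuPrimeStrip.toTimesMuFunctor).obj (withSingle M)) ∈
        (PolyIso.full M (withSingle M)).map (toSplitStripFunctor ⋙ FSplitTriMuPrimeStrip.toTimesMuFunctor) := by
      rw [hR]; exact PolyIso.mem_full _
    obtain ⟨e, -, -⟩ := PolyIso.mem_map.mp hmem
    exact not_iso_withSingle M hM e

end FVdashSplitTriMuPrimeStrip

end Literature.IUT.HodgeArakelov
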